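import Mathlib.Data.Fintype.Perm
import Literature.Computability.Complexity.DisjointnessRandomizedCommunication
import Literature.Computability.Complexity.KWProtocol
import Literature.Barriers.PneNP.MonotoneGap
import HarnessLib

/-!
# Raz–Wigderson: the monotone Karchmer–Wigderson game of bipartite perfect matching needs `Ω(n)`
# bits — PROVED (from the randomized lower bound for unique disjointness)

R. Raz, A. Wigderson, *Monotone circuits for matching require linear depth*, STOC 1990 / J. ACM 39
(1992), §3 (materialised `paper:doi-10-1145-100216-100253`, pp. 6–12: Prop. 3.1 `c(M̂) ≤ d_m(MATCH)`,
Prop. 3.2 `c̃(M) ≤ c(M̂) + 1` (remove a random point of `q`), Prop. 3.3/3.4 (encode `DISJ` through the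
3-letter distinctness function), Thm. 3.1 [KS] `c_{1/3}(DISJ) = Ω(m)`), Thm. 4.2 (p. 13: the
bipartite version `d_m(BPM) = Ω(n)` by vertex duplication); S. Jukna, *Boolean Function Complexity*
(2012), Thm. 7.26 and its proof (book pp. 219–221: reductions (a)–(d), the last one randomized by a
public random permutation of the vertices: "`P` returns each edge from `{e₁,…,e_k}` with equal
probability").

Main result (`bpm_monotoneKW_depth`; abstract form `kwDepth_of_correctOn` for trees correct on the
encoded pairs only, reused for CLIQUE in `MonotoneCliqueKWDepth.lean`): there are `c > 0`, `m₀` such that for `m ≥ m₀` and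
`n = 2m + r`, every protocol tree solving the MONOTONE Karchmer–Wigderson game of the bipartite
perfect matching function `perfectMatchingFn n` (`Literature.Barriers.PneNP.MonotoneGap`) has depth
`≥ c · m`.  The circuit statement `RazWigderson1992_bpm_monotoneDepth` follows with the tree's
Karchmer–Wigderson simulation (`Circuit.exists_kwTree_solvesMono`) in `MonotoneMatchingDepth.lean`.

## The proof formalised (RW §3 / Jukna (a)–(d), run directly on the bipartite game)

Vertices on each side: `V = (Fin m × Bool) ⊕ Fin r` (block `i` has the two vertices `(i, 0), (i, 1)`;
`r` padding vertices), identified with `Fin n` by a pair of bijections `e = (e_L, e_R)` which is the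
PUBLIC RANDOMNESS (uniform over all pairs; this is Jukna's random permutation `π`).
* Alice, holding `x ⊆ [m]`, plays the perfect matching `α_x` (`alicePerm`): block `i` is matched
  parallel `(i,β) ↦ (i,β)̄` if `i ∈ x` and crossed `(i,β) ↦ (i,¬β)̄` otherwise; padding vertices
  diagonally (RW Prop. 3.3/3.4: the encodings `τ`, `σ_I`).
* Bob, holding `y ⊆ [m]`, plays the graph of all edges meeting the vertex set `T(y)`
  (`inTL`/`inTR`): left vertices `(i,1)` for `i ≠ 0`, `(i,0)` for `i ∉ y`, all padding vertices;
  right vertices `(i,1)̄` for `i ∈ y`.  This is the cover `S(y)` (`(i,1),(i,1)̄` for `i ∈ y`;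
  `(i,0),(i,1)` for `i ∉ y`) with the point `v = (0,1)` REMOVED (RW Prop. 3.2; here the removed point
  is fixed, the random relabeling already makes the protocol's answer uniform); `|T| = n − 1 < n`, so
  Bob's graph has no perfect matching (`bobInput_eq_false`), while an edge of `α_x` avoids `S(y)` iff
  its block `i` lies in `x ∩ y` (`mem_inter_of_uncovered`).
* One run: play the given tree on the relabeled inputs, pull the answered edge back to `V` and vote
  "disjoint" iff its left end is `v` (`vote`).  If `x ∩ y = ∅` every run votes disjoint
  (`vote_of_disjoint`); if `|x ∩ y| = 1` at most half of the relabelings vote disjoint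
  (`two_mul_card_vote_le`: the relabelings `e ↦ e ∘ (swap v ℓ*, swap α(v) α(ℓ*))` exchange the two
  admissible answers — Jukna's "equal probability" / RW's "exactly two of these four cases").
* Three independent runs, answer "disjoint" iff all three vote so (`rwProtocol`; error `≤ 1/8` on
  uniquely intersecting pairs, `0` on disjoint pairs, depth `3 · depth`), and the tree's
  `razborov_disjointness_randomized` (Razborov 1992 / [KS]; error threshold `1/6`).

0 named facts.
-/

noncomputable section

namespace Literature.Computability.Complexity

open Finset Literature.Barriers.PneNP

/-! ### Protocol-tree plumbing -/

namespace KWTree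

universe u

variable {ι : Type u} {X Y : Type*}

/-- Play a Karchmer–Wigderson protocol tree on inputs preprocessed by `fA` (Alice) and `fB` (Bob):
the resulting two-party protocol tree on raw inputs `X × Y`. [cite: RazWigderson1990, §2 (Fact 2.1:
restrictions/reductions of relations)] -/
def toDet (fA : X → (ι → Bool)) (fB : Y → (ι → Bool)) : KWTree ι → DetProtocol X Y ι
  | leaf i => .leaf i
  | alice s P Q => .alice (fun x => s (fA x)) (toDet fA fB P) (toDet fA fB Q)
  | bob s P Q => .bob (fun y => s (fB y)) (toDet fA fB P) (toDet fA fB Q)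

/-- Run law of `toDet`. [cite: RazWigderson1990, §2 (Fact 2.1)] -/
@[simp] theorem run_toDet (fA : X → (ι → Bool)) (fB : Y → (ι → Bool)) :
    ∀ (T : KWTree ι) (x : X) (y : Y), (T.toDet fA fB).run x y = T.run (fA x) (fB y)
  | leaf _, _, _ => rfl
  | alice s P Q, x, y => by
      simp only [toDet, DetProtocol.run, run_alice, run_toDet fA fB P, run_toDet fA fB Q]
  | bob s P Q, x, y => by
      simp only [toDet, DetProtocol.run, run_bob, run_toDet fA fB P, run_toDet fA fB Q]

/-- Depth law of `toDet`. [cite: RazWigderson1990, §2 (Fact 2.1)] -/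
@[simp] theorem depth_toDet (fA : X → (ι → Bool)) (fB : Y → (ι → Bool)) :
    ∀ T : KWTree ι, (T.toDet fA fB).depth = T.depth
  | leaf _ => rfl
  | alice _ P Q => by simp only [toDet, DetProtocol.depth, depth_alice, depth_toDet fA fB P,
      depth_toDet fA fB Q]
  | bob _ P Q => by simp only [toDet, DetProtocol.depth, depth_bob, depth_toDet fA fB P,
      depth_toDet fA fB Q]

end KWTree

namespace DetProtocol

variable {X Y β γ : Type*}

/-- Sequential composition: continue at each leaf `b` with the protocol `f b`.
[cite: Jukna2012, Thm. 7.26 proof (d) ("repeat the protocol twice", p. 221)] -/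
def bind : DetProtocol X Y β → (β → DetProtocol X Y γ) → DetProtocol X Y γ
  | leaf b, f => f b
  | alice s P Q, f => alice s (bind P f) (bind Q f)
  | bob s P Q, f => bob s (bind P f) (bind Q f)

/-- Run law of `bind`. [cite: Jukna2012, Thm. 7.26 proof (d) (p. 221)] -/
@[simp] theorem run_bind (f : β → DetProtocol X Y γ) :
    ∀ (P : DetProtocol X Y β) (x : X) (y : Y), (P.bind f).run x y = (f (P.run x y)).run x y
  | leaf _, _, _ => rfl
  | alice s P Q, x, y => by
      simp only [bind, run]
      split <;> simp only [run_bind f P, run_bind f Q]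
  | bob s P Q, x, y => by
      simp only [bind, run]
      split <;> simp only [run_bind f P, run_bind f Q]

/-- Depth law of `bind`. [cite: Jukna2012, Thm. 7.26 proof (d) (p. 221)] -/
theorem depth_bind_le (f : β → DetProtocol X Y γ) {d : ℕ} (hf : ∀ b, (f b).depth ≤ d) :
    ∀ P : DetProtocol X Y β, (P.bind f).depth ≤ P.depth + d
  | leaf b => by simpa [bind, depth] using hf b
  | alice s P Q => by
      have hP := depth_bind_le f hf P
      have hQ := depth_bind_le f hf Q
      simp only [bind, depth]
      omega
  | bob s P Q => by
      have hP := depth_bind_le f hf P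
      have hQ := depth_bind_le f hf Q
      simp only [bind, depth]
      omega

end DetProtocol

/-! ### The encoding of disjointness into the matching game -/

namespace RWMatching

variable {m r n : ℕ}

/-- The vertex type of one side: two vertices `(i, 0), (i, 1)` per block `i < m` and `r` padding
vertices. [cite: RazWigderson1990, §3 (the triples `S_i`) and Thm. 4.2 (vertex duplication)] -/
abbrev Vert (m r : ℕ) : Type := (Fin m × Bool) ⊕ Fin r

/-- `|V| = 2m + r`. [cite: RazWigderson1990, §3] -/
theorem card_vert (m r : ℕ) : Fintype.card (Vert m r) = 2 * m + r := by
  simp [Fintype.card_sum, Fintype.card_prod, mul_comm]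

/-- Alice's matching as a map on vertices: parallel on the blocks in `x`, crossed on the others,
diagonal on the padding. [cite: RazWigderson1990, Prop. 3.3/3.4 (the encodings σ_I ∘ τ_I)] -/
def aliceMap (x : Finset (Fin m)) : Vert m r → Vert m r
  | .inl (i, β) => .inl (i, if i ∈ x then β else !β)
  | .inr k => .inr k

/-- `aliceMap x` is an involution. [cite: RazWigderson1990, Prop. 3.3] -/
theorem aliceMap_involutive (x : Finset (Fin m)) : Function.Involutive (aliceMap (r := r) x) := by
  rintro (⟨i, β⟩ | k)
  · by_cases hi : i ∈ x <;> simp [aliceMap, hi]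
  · rfl

/-- Alice's perfect matching `α_x`, as a permutation of the vertex type (left vertex `w` is matched
to right vertex `α_x w`). [cite: RazWigderson1990, Prop. 3.3/3.4] -/
def alicePerm (x : Finset (Fin m)) : Equiv.Perm (Vert m r) :=
  (aliceMap_involutive (r := r) x).toPerm _

/-- Unfolding `alicePerm`. [cite: RazWigderson1990, Prop. 3.3/3.4] -/
@[simp] theorem alicePerm_apply (x : Finset (Fin m)) (w : Vert m r) :
    alicePerm x w = aliceMap x w := rfl

/-- The removed cover point `v = (0, 1)` (a left vertex lying in Bob's cover for every `y`).
[cite: RazWigderson1990, Prop. 3.2 ("removes one point u ∈ q")] -/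
def rmv (hm : 0 < m) : Vert m r := .inl (⟨0, hm⟩, true)

/-- Bob's left cover `T_L(y)`: `(i,1)` for `i ≠ 0`, `(i,0)` for `i ∉ y`, all padding vertices — the
left part of the cover `S(y)` minus the removed point `v`. [cite: RazWigderson1990, Prop. 3.2–3.4
(σ_II ∘ τ_II and q̂ = q ∖ {u})] -/
def inTL (hm : 0 < m) (y : Finset (Fin m)) : Vert m r → Bool
  | .inl (i, β) => (β || !decide (i ∈ y)) && !(decide (i = ⟨0, hm⟩) && β)
  | .inr _ => true

/-- Bob's right cover `T_R(y)`: `(i,1)̄` for `i ∈ y`. [cite: RazWigderson1990, Prop. 3.3/3.4] -/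
def inTR (y : Finset (Fin m)) : Vert m r → Bool
  | .inl (i, β) => β && decide (i ∈ y)
  | .inr _ => false

/-- The removed point is not in `T_L`. [cite: RazWigderson1990, Prop. 3.2] -/
@[simp] theorem inTL_rmv (hm : 0 < m) (y : Finset (Fin m)) : inTL (r := r) hm y (rmv hm) = false := by
  simp [inTL, rmv]

/-- **The block analysis.**  A left vertex `w ≠ v` outside `T_L(y)` whose partner `α_x w` is outside
`T_R(y)` is the vertex `(i, 0)` of a block `i ∈ x ∩ y`. [cite: RazWigderson1990, Prop. 3.3/3.4
("DISJ(x,y) = DIST(τ_I(x), τ_II(y))", "(p,q) ∈ W_i")] [cite: Jukna2012, Thm. 7.26 proof (b),(c)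
(p. 220)] -/
theorem mem_inter_of_uncovered (hm : 0 < m) {x y : Finset (Fin m)} {w : Vert m r}
    (hL : inTL hm y w = false) (hR : inTR y (aliceMap x w) = false) (hw : w ≠ rmv hm) :
    ∃ i, i ∈ x ∩ y ∧ w = .inl (i, false) := by
  rcases w with ⟨i, β⟩ | k
  · refine ⟨i, ?_⟩
    by_cases hiy : i ∈ y <;> by_cases hix : i ∈ x <;> cases β <;>
      simp_all [inTL, inTR, aliceMap, rmv]
  · simp [inTL] at hL

/-! ### The inputs on `Fin n × Fin n` under a relabeling -/

/-- A relabeling: bijections of the left and of the right vertex set with `Fin n` (the public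
randomness). [cite: Jukna2012, Thm. 7.26 proof (d) ("flip coins publicly and choose a random
permutation π", p. 221)] -/
abbrev Relab (m r n : ℕ) : Type := (Vert m r ≃ Fin n) × (Vert m r ≃ Fin n)

/-- Alice's input graph: the relabeled perfect matching `α_x`. [cite: RazWigderson1990, Prop. 3.3] -/
def aliceInput (x : Finset (Fin m)) (e : Relab m r n) : Fin n × Fin n → Bool :=
  fun lr => decide (e.2 (aliceMap x (e.1.symm lr.1)) = lr.2)

/-- Bob's input graph: all edges meeting the relabeled cover `T(y)`. [cite: RazWigderson1990,
Prop. 3.1 ("q̂ interpreted as a clique on N ∖ q̂ is a maxterm")] -/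
def bobInput (hm : 0 < m) (y : Finset (Fin m)) (e : Relab m r n) : Fin n × Fin n → Bool :=
  fun lr => inTL hm y (e.1.symm lr.1) || inTR y (e.2.symm lr.2)

/-- Alice's graph has a perfect matching. [cite: RazWigderson1990, Prop. 3.1 (P_N = minterms)] -/
theorem aliceInput_eq_true (x : Finset (Fin m)) (e : Relab m r n) :
    perfectMatchingFn n (aliceInput x e) = true := by
  rw [perfectMatchingFn_eq_true_iff]
  refine ⟨e.1.symm.trans ((alicePerm (r := r) x).trans e.2), fun i => ?_⟩
  simp [aliceInput]

/-- Bob's graph has no perfect matching: the `|y| + 1` left vertices `v, (i,0) (i ∈ y)` outside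
`T_L` would have to be matched into the `|y|` right vertices `(i,1)̄ (i ∈ y)` of `T_R`.
[cite: RazWigderson1990, Prop. 3.1 (maxterms Q̂_N)] [cite: Jukna2012, Thm. 7.26 proof ("the
complement of c_q can contain no m-matching", p. 219)] -/
theorem bobInput_eq_false (hm : 0 < m) (y : Finset (Fin m)) (e : Relab m r n) :
    perfectMatchingFn n (bobInput hm y e) = false := by
  classical
  rw [Bool.eq_false_iff, ne_eq, perfectMatchingFn_eq_true_iff, not_exists]
  intro σ hσ
  -- the uncovered left vertices and the right cover, inside `V`
  let A : Finset (Vert m r) := insert (rmv hm) (y.map ⟨fun i => Sum.inl (i, false), fun i j h => by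
    simpa using h⟩)
  let B : Finset (Vert m r) := y.map ⟨fun i => Sum.inl (i, true), fun i j h => by simpa using h⟩
  have hA : A.card = y.card + 1 := by
    rw [Finset.card_insert_of_notMem (by simp [rmv]), Finset.card_map]
  have hB : B.card = y.card := Finset.card_map _
  -- `w ↦ e_R⁻¹ (σ (e_L w))` maps `A` injectively into `B`
  let g : Vert m r → Vert m r := fun w => e.2.symm (σ (e.1 w))
  have hg : ∀ w ∈ A, g w ∈ B := by
    intro w hw
    have h := hσ (e.1 w)
    simp only [bobInput, Equiv.symm_apply_apply, Bool.or_eq_true] at h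
    have hL : inTL (r := r) hm y w = false := by
      simp only [A, Finset.mem_insert, Finset.mem_map, Function.Embedding.coeFn_mk] at hw
      rcases hw with rfl | ⟨i, hi, rfl⟩
      · exact inTL_rmv hm y
      · simp [inTL, hi]
    rw [hL] at h
    simp only [Bool.false_eq_true, false_or] at h
    -- `inTR y (g w) = true` forces `g w = (i,1)̄` with `i ∈ y`
    change inTR y (g w) = true at h
    rcases hgw : g w with ⟨i, β⟩ | k
    · rw [hgw] at h
      cases β
      · simp [inTR] at h
      · simp only [inTR, Bool.true_and, decide_eq_true_eq] at h
        simp only [B, Finset.mem_map, Function.Embedding.coeFn_mk]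
        exact ⟨i, h, rfl⟩
    · rw [hgw] at h; simp [inTR] at h
  have hinj : Set.InjOn g A := fun w _ w' _ h => by
    simpa [g] using h
  have := Finset.card_le_card_of_injOn g hg hinj
  omega

/-- `T` answers the monotone game correctly on all ENCODED input pairs — the only property of
`T` the reduction uses; every tree solving the monotone Karchmer–Wigderson game of
`perfectMatchingFn n` has it (`correctOn_of_solvesMono`), and so do trees obtained from protocols
for other games by relabeling (RW Thm. 4.3). [cite: RazWigderson1990, §2 Fact 2.1 (restrictions
of relations) and Prop. 3.1] -/
def CorrectOn (r : ℕ) (hm : 0 < m) (T : KWTree (Fin n × Fin n)) : Prop :=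
  ∀ (x y : Finset (Fin m)) (e : Relab m r n),
    aliceInput x e (T.run (aliceInput x e) (bobInput hm y e)) = true ∧
      bobInput hm y e (T.run (aliceInput x e) (bobInput hm y e)) = false

/-- A tree solving the monotone game of `perfectMatchingFn n` is correct on the encoded pairs.
[cite: RazWigderson1990, Prop. 3.1] -/
theorem correctOn_of_solvesMono (hm : 0 < m) {T : KWTree (Fin n × Fin n)}
    (hT : T.SolvesMono (perfectMatchingFn n)) : CorrectOn r hm T :=
  fun x y e => hT _ _ (aliceInput_eq_true x e) (bobInput_eq_false hm y e)

/-! ### One run and its vote -/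

/-- The block index pulled back from the protocol's answer: the left endpoint of the answered edge,
read in `V`. [cite: Jukna2012, Thm. 7.26 proof (d) (p. 221)] -/
def pulled (hm : 0 < m) (T : KWTree (Fin n × Fin n)) (x y : Finset (Fin m)) (e : Relab m r n) :
    Vert m r :=
  e.1.symm (T.run (aliceInput x e) (bobInput hm y e)).1

/-- The vote of one run: "disjoint" iff the answered edge hangs at the removed point `v`.
[cite: RazWigderson1990, Prop. 3.2 ("B(p,q) = 1 if u ∈ e")] -/
def vote (hm : 0 < m) (T : KWTree (Fin n × Fin n)) (x y : Finset (Fin m)) (e : Relab m r n) : Bool :=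
  decide (pulled hm T x y e = rmv hm)

/-- What a correct answer says, pulled back to `V`: its left end `w` is outside `T_L(y)` and its
partner `α_x w` (the right end) is outside `T_R(y)`. [cite: RazWigderson1990, Prop. 3.1] -/
theorem pulled_spec (hm : 0 < m) {T : KWTree (Fin n × Fin n)} (hT : CorrectOn r hm T)
    (x y : Finset (Fin m)) (e : Relab m r n) :
    inTL hm y (pulled hm T x y e) = false ∧ inTR y (aliceMap x (pulled hm T x y e)) = false := by
  obtain ⟨ha, hb⟩ := hT x y e
  simp only [aliceInput, decide_eq_true_eq] at ha
  simp only [bobInput, Bool.or_eq_false_iff] at hb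
  refine ⟨hb.1, ?_⟩
  have h2 := hb.2
  rw [← ha, Equiv.symm_apply_apply] at h2
  exact h2

/-- **Disjoint pairs always vote "disjoint".** [cite: RazWigderson1990, Prop. 3.2 ("if (p,q) ∈ W₀
then B(p,q) = 1 (correctly)")] -/
theorem vote_of_disjoint (hm : 0 < m) {T : KWTree (Fin n × Fin n)}
    (hT : CorrectOn r hm T) {x y : Finset (Fin m)} (hxy : Disjoint x y)
    (e : Relab m r n) : vote hm T x y e = true := by
  obtain ⟨hL, hR⟩ := pulled_spec hm hT x y e
  rw [vote, decide_eq_true_eq]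
  by_contra hne
  obtain ⟨i, hi, -⟩ := mem_inter_of_uncovered hm hL hR hne
  rw [Finset.disjoint_iff_inter_eq_empty] at hxy
  rw [hxy] at hi
  simp at hi

/-- Precomposing a relabeling with vertex permutations. [cite: Jukna2012, Thm. 7.26 proof (d)
(random permutation π, p. 221)] -/
def twist (σL σR : Equiv.Perm (Vert m r)) (e : Relab m r n) : Relab m r n :=
  (σL.trans e.1, σR.trans e.2)

/-- `twist` by fixed permutations is injective. [cite: Jukna2012, Thm. 7.26 proof (d) (p. 221)] -/
theorem twist_injective (σL σR : Equiv.Perm (Vert m r)) :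
    Function.Injective (twist (n := n) σL σR) := by
  intro e e' h
  simp only [twist, Prod.mk.injEq] at h
  obtain ⟨h1, h2⟩ := h
  refine Prod.ext (Equiv.ext fun w => ?_) (Equiv.ext fun w => ?_)
  · have := congrArg (fun f : Vert m r ≃ Fin n => f (σL.symm w)) h1
    simpa using this
  · have := congrArg (fun f : Vert m r ≃ Fin n => f (σR.symm w)) h2
    simpa using this

/-- A Boolean function taking equal values at `a` and `b` is invariant under `swap a b`. [folklore] -/
private theorem apply_swap_eq {α : Type*} [DecidableEq α] (f : α → Bool) {a b : α} (h : f a = f b)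
    (w : α) : f (Equiv.swap a b w) = f w := by
  rcases eq_or_ne w a with rfl | hwa
  · rw [Equiv.swap_apply_left, h]
  rcases eq_or_ne w b with rfl | hwb
  · rw [Equiv.swap_apply_right, h]
  rw [Equiv.swap_apply_of_ne_of_ne hwa hwb]

/-- **The exchange symmetry (Jukna: "`P` returns each edge from `{e₁,…,e_k}` with equal
probability"; RW Prop. 3.2: "exactly two of these four cases").**  If `x ∩ y = {i⋆}`, put
`ℓ⋆ = (i⋆, 0)`, `σ_L = swap v ℓ⋆`, `σ_R = swap α_x(v) α_x(ℓ⋆)`; when `α_x(v) ∉ T_R(y)`, twisting the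
relabeling by `(σ_L, σ_R)` leaves both players' inputs unchanged and moves the pulled-back answer by
`σ_L`. [cite: Jukna2012, Thm. 7.26 proof (d) (p. 221)] [cite: RazWigderson1990, Prop. 3.2] -/
theorem inputs_twist (hm : 0 < m) {x y : Finset (Fin m)} {i : Fin m} (hi : x ∩ y = {i})
    (hv : inTR y (aliceMap (r := r) x (rmv hm)) = false) (e : Relab m r n) :
    let ℓ : Vert m r := .inl (i, false)
    let σL : Equiv.Perm (Vert m r) := Equiv.swap (rmv hm) ℓ
    let σR : Equiv.Perm (Vert m r) := Equiv.swap (aliceMap x (rmv hm)) (aliceMap x ℓ)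
    aliceInput x (twist σL σR e) = aliceInput x e ∧
      bobInput hm y (twist σL σR e) = bobInput hm y e := by
  intro ℓ σL σR
  have hix : i ∈ x := Finset.mem_of_mem_inter_left (hi.symm ▸ Finset.mem_singleton_self i)
  have hiy : i ∈ y := Finset.mem_of_mem_inter_right (hi.symm ▸ Finset.mem_singleton_self i)
  have hαℓ : aliceMap (r := r) x ℓ = .inl (i, false) := by simp [ℓ, aliceMap, hix]
  -- `σ_R ∘ α ∘ σ_L = α`
  have hconj : ∀ w, aliceMap x (σL w) = σR (aliceMap (r := r) x w) := by
    intro w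
    have hinj : Function.Injective (aliceMap (r := r) x) := (aliceMap_involutive x).injective
    rcases eq_or_ne w (rmv hm) with rfl | h1
    · simp only [σL, σR, Equiv.swap_apply_left]
    rcases eq_or_ne w ℓ with rfl | h2
    · simp only [σL, σR, Equiv.swap_apply_right]
    · rw [Equiv.swap_apply_of_ne_of_ne h1 h2,
        Equiv.swap_apply_of_ne_of_ne (hinj.ne h1) (hinj.ne h2)]
  constructor
  · funext lr
    simp only [aliceInput, twist, Equiv.symm_trans_apply, Equiv.trans_apply]
    rw [decide_eq_decide, show σL.symm = σL from rfl, hconj, Equiv.swap_apply_self]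
  · funext lr
    simp only [bobInput, twist, Equiv.symm_trans_apply]
    rw [show σL.symm = σL from rfl, show σR.symm = σR from rfl]
    rw [apply_swap_eq (inTL hm y) (by rw [inTL_rmv]; simp [ℓ, inTL, hiy]),
      apply_swap_eq (inTR y) (by rw [hv, hαℓ]; simp [inTR])]

/-- **At most half of the relabelings vote "disjoint" on a uniquely intersecting pair.**
[cite: Jukna2012, Thm. 7.26 proof (d) ("the probability of error is at most 1/2", p. 221)]
[cite: RazWigderson1990, Prop. 3.2] -/
theorem two_mul_card_vote_le (hm : 0 < m) {T : KWTree (Fin n × Fin n)}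
    (hT : CorrectOn r hm T) {x y : Finset (Fin m)} (hxy : (x ∩ y).card = 1) :
    2 * (Finset.univ.filter fun e : Relab m r n => vote hm T x y e = true).card ≤
      Fintype.card (Relab m r n) := by
  classical
  obtain ⟨i, hi⟩ := Finset.card_eq_one.1 hxy
  set Vt := Finset.univ.filter fun e : Relab m r n => vote hm T x y e = true with hVt
  by_cases hv : inTR y (aliceMap (r := r) x (rmv hm)) = true
  · -- degenerate case: the removed point is covered from the right, nobody votes
    have hempty : Vt = ∅ := by
      refine Finset.eq_empty_of_forall_notMem fun e he => ?_
      simp only [hVt, Finset.mem_filter, Finset.mem_univ, true_and, vote, decide_eq_true_eq] at he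
      have := (pulled_spec hm hT x y e).2
      rw [he, hv] at this
      exact Bool.noConfusion this
    rw [hempty]; simp
  rw [Bool.not_eq_true] at hv
  let ℓ : Vert m r := .inl (i, false)
  let σL : Equiv.Perm (Vert m r) := Equiv.swap (rmv hm) ℓ
  let σR : Equiv.Perm (Vert m r) := Equiv.swap (aliceMap x (rmv hm)) (aliceMap x ℓ)
  have hℓv : ℓ ≠ rmv hm := by simp [ℓ, rmv]
  -- the twist maps voters to non-voters, injectively
  have hmap : ∀ e ∈ Vt, twist σL σR e ∈ Vtᶜ := by
    intro e he
    simp only [hVt, Finset.mem_compl, Finset.mem_filter, Finset.mem_univ, true_and, vote,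
      decide_eq_true_eq] at he ⊢
    obtain ⟨h1, h2⟩ := inputs_twist hm hi hv e
    unfold pulled at he ⊢
    rw [h1, h2]
    simp only [twist, Equiv.symm_trans_apply]
    rw [he, show σL.symm = σL from rfl]
    simp only [σL, Equiv.swap_apply_left]
    exact hℓv
  have hcard := Finset.card_le_card_of_injOn (twist σL σR) hmap
    ((twist_injective σL σR).injOn)
  rw [Finset.card_compl] at hcard
  have : Vt.card ≤ Fintype.card (Relab m r n) := Finset.card_le_univ _
  omega

/-! ### The randomized protocol for disjointness -/

variable (hm : 0 < m) (T : KWTree (Fin n × Fin n))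

/-- One run: play `T` on the relabeled inputs and output the pulled-back left end of the answer.
[cite: Jukna2012, Thm. 7.26 proof (d) (p. 221)] -/
def oneRun (e : Relab m r n) : DetProtocol (Finset (Fin m)) (Finset (Fin m)) (Vert m r) :=
  (T.toDet (fun x => aliceInput x e) (fun y => bobInput hm y e)).bind fun edge =>
    .leaf (e.1.symm edge.1)

/-- Run law of `oneRun`. [cite: Jukna2012, Thm. 7.26 proof (d) (p. 221)] -/
@[simp] theorem run_oneRun (e : Relab m r n) (x y : Finset (Fin m)) :
    (oneRun hm T e).run x y = pulled hm T x y e := by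
  simp [oneRun, pulled, DetProtocol.run]

/-- `oneRun` costs `depth T` bits. [cite: RazWigderson1990, Prop. 3.2 (c̃(M) ≤ c(M̂) + 1; here + 0)] -/
theorem depth_oneRun_le (e : Relab m r n) : (oneRun hm T e).depth ≤ T.depth := by
  have h := DetProtocol.depth_bind_le (fun edge : Fin n × Fin n =>
    (DetProtocol.leaf (e.1.symm edge.1) : DetProtocol (Finset (Fin m)) (Finset (Fin m)) (Vert m r)))
    (d := 0) (fun _ => le_rfl) (T.toDet (fun x => aliceInput x e) (fun y => bobInput hm y e))
  simpa [oneRun] using h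

/-- The last run, reporting its vote. [cite: Jukna2012, Thm. 7.26 proof (d) (p. 221)] -/
def run3 (e : Relab m r n) : DetProtocol (Finset (Fin m)) (Finset (Fin m)) Bool :=
  (oneRun hm T e).bind fun w => .leaf (decide (w = rmv hm))

/-- The last two runs: continue only if the second run votes "disjoint". [cite: Jukna2012,
Thm. 7.26 proof (d) ("repeat the protocol", p. 221)] -/
def run2 (e₂ e₃ : Relab m r n) : DetProtocol (Finset (Fin m)) (Finset (Fin m)) Bool :=
  (oneRun hm T e₂).bind fun w => if w = rmv hm then run3 hm T e₃ else .leaf false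

/-- **The randomized protocol for disjointness**: three independent runs; answer "disjoint" iff all
three vote so. [cite: Jukna2012, Thm. 7.26 proof (d) (p. 221)] [cite: RazWigderson1990, §3
(Props. 3.1–3.4)] -/
def rwProtocol (ρ : Relab m r n × Relab m r n × Relab m r n) :
    DetProtocol (Finset (Fin m)) (Finset (Fin m)) Bool :=
  (oneRun hm T ρ.1).bind fun w => if w = rmv hm then run2 hm T ρ.2.1 ρ.2.2 else .leaf false

/-- Run law of `run3`. [cite: Jukna2012, Thm. 7.26 proof (d) (p. 221)] -/
theorem run_run3 (e : Relab m r n) (x y : Finset (Fin m)) :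
    (run3 hm T e).run x y = vote hm T x y e := by
  simp [run3, vote, DetProtocol.run]

/-- Run law of `run2`. [cite: Jukna2012, Thm. 7.26 proof (d) (p. 221)] -/
theorem run_run2 (e₂ e₃ : Relab m r n) (x y : Finset (Fin m)) :
    (run2 hm T e₂ e₃).run x y = (vote hm T x y e₂ && vote hm T x y e₃) := by
  unfold run2
  rw [DetProtocol.run_bind, run_oneRun]
  by_cases h : pulled hm T x y e₂ = rmv hm
  · rw [if_pos h, run_run3]; simp [vote, h]
  · rw [if_neg h]; simp [vote, h, DetProtocol.run]

/-- Run law of `rwProtocol`. [cite: Jukna2012, Thm. 7.26 proof (d) (p. 221)] -/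
theorem run_rwProtocol (ρ : Relab m r n × Relab m r n × Relab m r n) (x y : Finset (Fin m)) :
    (rwProtocol hm T ρ).run x y =
      (vote hm T x y ρ.1 && (vote hm T x y ρ.2.1 && vote hm T x y ρ.2.2)) := by
  unfold rwProtocol
  rw [DetProtocol.run_bind, run_oneRun]
  by_cases h : pulled hm T x y ρ.1 = rmv hm
  · rw [if_pos h, run_run2]; simp [vote, h]
  · rw [if_neg h]; simp [vote, h, DetProtocol.run]

/-- `run3` costs `≤ depth T` bits. [cite: Jukna2012, Thm. 7.26 proof (d) (p. 221)] -/
theorem depth_run3_le (e : Relab m r n) : (run3 hm T e).depth ≤ T.depth := by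
  have h := DetProtocol.depth_bind_le (fun w : Vert m r =>
    (DetProtocol.leaf (decide (w = rmv hm)) : DetProtocol (Finset (Fin m)) (Finset (Fin m)) Bool))
    (d := 0) (fun _ => le_rfl) (oneRun hm T e)
  have h' := depth_oneRun_le hm T e
  unfold run3
  omega

/-- `run2` costs `≤ 2 · depth T` bits. [cite: Jukna2012, Thm. 7.26 proof (d) (p. 221)] -/
theorem depth_run2_le (e₂ e₃ : Relab m r n) : (run2 hm T e₂ e₃).depth ≤ 2 * T.depth := by
  have h := DetProtocol.depth_bind_le
    (fun w : Vert m r => if w = rmv hm then run3 hm T e₃ else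
      (DetProtocol.leaf false : DetProtocol (Finset (Fin m)) (Finset (Fin m)) Bool))
    (d := T.depth) (fun w => by
      split
      · exact depth_run3_le hm T e₃
      · exact Nat.zero_le _) (oneRun hm T e₂)
  have h' := depth_oneRun_le hm T e₂
  unfold run2
  omega

/-- `rwProtocol` costs `≤ 3 · depth T` bits. [cite: Jukna2012, Thm. 7.26 proof (d) (p. 221)] -/
theorem depth_rwProtocol_le (ρ : Relab m r n × Relab m r n × Relab m r n) :
    (rwProtocol hm T ρ).depth ≤ 3 * T.depth := by
  have h := DetProtocol.depth_bind_le
    (fun w : Vert m r => if w = rmv hm then run2 hm T ρ.2.1 ρ.2.2 else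
      (DetProtocol.leaf false : DetProtocol (Finset (Fin m)) (Finset (Fin m)) Bool))
    (d := 2 * T.depth) (fun w => by
      split
      · exact depth_run2_le hm T ρ.2.1 ρ.2.2
      · exact Nat.zero_le _) (oneRun hm T ρ.1)
  have h' := depth_oneRun_le hm T ρ.1
  unfold rwProtocol
  omega

/-! ### The depth bound -/

/-- **The reduction, abstract form**: every protocol tree on `Fin n × Fin n` that is correct on the
encoded pairs (`CorrectOn`) has depth `≥ c · m` (`n = 2m + r`, `m ≥ m₀`; `c` = one third of the
constant of the tree's `razborov_disjointness_randomized`). [cite: RazWigderson1990, §3 (Props.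
3.1–3.4 and Thm. 3.1)] [cite: Jukna2012, Thm. 7.26 (pp. 219–221)] -/
theorem kwDepth_of_correctOn :
    ∃ c : ℝ, 0 < c ∧ ∃ m₀ : ℕ, ∀ (m r n : ℕ) (hm0 : 0 < m), m₀ ≤ m → 2 * m + r = n →
      ∀ T : KWTree (Fin n × Fin n), CorrectOn r hm0 T → c * m ≤ (T.depth : ℝ) := by
  classical
  obtain ⟨c, hc, n₀, H⟩ := razborov_disjointness_randomized
  refine ⟨c / 3, by positivity, n₀, fun m r n hm0 hmn₀ hn T hT => ?_⟩
  have hcardV : Fintype.card (Vert m r) = n := by rw [card_vert, hn]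
  let e₀ : Vert m r ≃ Fin n := Fintype.equivFinOfCardEq hcardV
  haveI : Nonempty (Relab m r n) := ⟨(e₀, e₀)⟩
  letI : DecidableEq (Vert m r) := inferInstance
  letI instR : Fintype (Relab m r n) := inferInstance
  letI : Fintype (Relab m r n × Relab m r n) := inferInstance
  letI : Fintype (Relab m r n × Relab m r n × Relab m r n) := inferInstance
  have hN : (0 : ℝ) < Fintype.card (Relab m r n) := by exact_mod_cast Fintype.card_pos
  have hR : (0 : ℝ) < Fintype.card (Relab m r n × Relab m r n × Relab m r n) := by
    exact_mod_cast Fintype.card_pos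
  set N₃ : ℝ := (Fintype.card (Relab m r n × Relab m r n × Relab m r n) : ℝ) with hN₃
  let p : Relab m r n × Relab m r n × Relab m r n → ℝ := fun _ => 1 / N₃
  have hp0 : ∀ ρ, 0 ≤ p ρ := fun _ => by positivity
  have hp1 : ∑ ρ, p ρ = 1 := by
    simp only [p, Finset.sum_const, Finset.card_univ, nsmul_eq_mul]
    rw [← hN₃, mul_one_div_cancel hR.ne']
  have key := H m hmn₀ (Relab m r n × Relab m r n × Relab m r n) p hp0 hp1
    (fun ρ => rwProtocol hm0 T ρ) (3 * T.depth) (fun ρ => depth_rwProtocol_le hm0 T ρ) ?_ ?_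
  · push_cast at key
    linarith
  · -- disjoint pairs: every run votes "disjoint"
    intro x y hxy
    have hall : ∀ ρ : Relab m r n × Relab m r n × Relab m r n,
        (rwProtocol hm0 T ρ).run x y = true := fun ρ => by
      rw [run_rwProtocol]
      simp [vote_of_disjoint hm0 hT hxy]
    simp only [hall, if_true, mul_one, hp1]
    norm_num
  · -- uniquely intersecting pairs: all three runs err with probability ≤ 1/8
    intro x y hxy
    have hV := two_mul_card_vote_le (r := r) (n := n) hm0 hT hxy
    set Vt := (Finset.univ.filter fun e : Relab m r n => vote hm0 T x y e = true) with hVt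
    have hset : (Finset.univ.filter fun ρ : Relab m r n × Relab m r n × Relab m r n =>
        (rwProtocol hm0 T ρ).run x y = true) = Vt ×ˢ (Vt ×ˢ Vt) := by
      ext ρ
      simp [hVt, run_rwProtocol, Bool.and_eq_true, Finset.mem_product]
    have hsum : ∑ ρ, p ρ * (if (rwProtocol hm0 T ρ).run x y = true then (1 : ℝ) else 0) =
        (1 / N₃) * (Vt.card : ℝ) ^ 3 := by
      simp only [p]
      rw [← Finset.mul_sum, Finset.sum_boole, hset, Finset.card_product, Finset.card_product]
      push_cast
      ring
    have hcardR : N₃ = (Fintype.card (Relab m r n) : ℝ) ^ 3 := by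
      rw [hN₃]; simp only [Fintype.card_prod]; push_cast; ring
    rw [hsum, hcardR]
    have h2 : (Vt.card : ℝ) / Fintype.card (Relab m r n) ≤ 1 / 2 := by
      rw [div_le_iff₀ hN]
      have : (2 * Vt.card : ℝ) ≤ Fintype.card (Relab m r n) := by exact_mod_cast hV
      linarith
    have h3 : ((Vt.card : ℝ) / Fintype.card (Relab m r n)) ^ 3 ≤ (1 / 2) ^ 3 :=
      pow_le_pow_left₀ (by positivity) h2 3
    calc 1 / (Fintype.card (Relab m r n) : ℝ) ^ 3 * (Vt.card : ℝ) ^ 3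
        = ((Vt.card : ℝ) / Fintype.card (Relab m r n)) ^ 3 := by
          rw [div_pow]; ring
      _ ≤ (1 / 2) ^ 3 := h3
      _ ≤ 1 / 6 := by norm_num

/-- ★ **Raz–Wigderson, communication form: the monotone Karchmer–Wigderson game of bipartite
perfect matching needs `Ω(n)` bits.**  There are `c > 0` and `m₀` such that for all `m ≥ m₀`, `r`,
`n = 2m + r`: every protocol tree solving the monotone Karchmer–Wigderson game of
`perfectMatchingFn n` has depth at least `c · m`. [cite: RazWigderson1990, §3 (Main Theorem via
Props. 3.1–3.4 and Thm. 3.1) and Thm. 4.2 (p. 13)] [cite: Jukna2012, Thm. 7.26 (pp. 219–221)] -/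
theorem bpm_monotoneKW_depth :
    ∃ c : ℝ, 0 < c ∧ ∃ m₀ : ℕ, ∀ (m r n : ℕ), m₀ ≤ m → 2 * m + r = n →
      ∀ T : KWTree (Fin n × Fin n), T.SolvesMono (perfectMatchingFn n) → c * m ≤ (T.depth : ℝ) := by
  obtain ⟨c, hc, m₀, H⟩ := kwDepth_of_correctOn
  refine ⟨c, hc, max m₀ 1, fun m r n hm hn T hT => ?_⟩
  have hm0 : 0 < m := lt_of_lt_of_le (Nat.lt_of_lt_of_le Nat.zero_lt_one (le_max_right m₀ 1)) hm
  exact H m r n hm0 (le_trans (le_max_left _ _) hm) hn T (correctOn_of_solvesMono hm0 hT)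

end RWMatching

end Literature.Computability.Complexity

end
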